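import Summits.Schanuel.Schanuel.Theorems.RootDecomp1NonModular

/-!
# RootDecomp1 — PILLAY'S TUPLE: an entangled exponential configuration without modular witness (lens-1 round 11, part C;
`--supports stmt-Schanuel-30352`)

`z = pillayTuple u = (u, v(u), u²)` with `v(u) = e^{u²} − u e^u`, so that `ℚ(e^z) = ℚ(u e^u + v, e^u, e^v)`.  Under the genericity
hypothesis «`u, v(u), e^u, e^{v(u)}` algebraically independent»: `z` is ℚ-linearly independent, ENTANGLED
(`trdeg ℚ(z, e^z) = 4 < 2 + 3`, `entangled_pillayTuple`, so NOT in the disjoint class, `not_disjoint_pillayTuple`) and has NO modular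
witness (`not_modularWitness_pillayTuple`, from part B): no transcendental shared element, no dark / log-dark line in its span.  If
`u ∈ ecl ∅` then every coordinate lies in `ecl ∅` (`pillayTuple_mem_ecl`).
-/

set_option linter.dupNamespace false

noncomputable section

namespace Summit.Schanuel.Schanuel.Theorems.RootDecomp1ModularLayer

open Complex IntermediateField
open scoped BigOperators Cardinal
open Summit.Schanuel.Schanuel.Theorems.RootDecomp1EAnchor (isAlgebraic_of_trdeg_sandwich trdeg_adjoin_le_of_isAlgebraic
  trdeg_adjoin_union_le trdeg_adjoin_le_nat exists_nat_eq_of_le_natCast isAlgebraic_of_mem_adjoin isAlgebraic_of_le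
  isAlgebraic_of_isAlgebraic_adjoin trdeg_adjoin_sum_le_union one_le_trdeg_adjoin_singleton)
open Summit.Schanuel.Schanuel.Theorems.RootDecomp1ArgumentCells (le_trdeg_of_algebraicIndependent_mem)
open Summit.Schanuel.Schanuel.Theorems.RootDecomp1AtomRigidity (mem_adjoin_range_of_mem_span_int
  exp_mem_adjoin_exp_of_mem_span_int)
open Summit.Schanuel.Schanuel.Theorems.RootDecomp1SharedDegree (trdeg_union_add_one_le_of_shared
  entangled_of_shared_transcendental lt_of_add_one_le_of_le_nat)
open Literature.NumberTheory.Transcendental (SchanuelRank transcendental_exp transcendental_exp_holds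
  exists_nsmul_mem_span_int isAlgebraic_adjoin_over_algebraAdjoin)
open Literature.NumberTheory.Transcendental.OneMotiveToric (trdeg_mono)
open Literature.Barriers.Schanuel (algebraicIndependent_of_le_trdeg_adjoin trdeg_adjoin_union_eq_of_isAlgebraic)

/-- (private copy; the public form is a print-twin of a landed declaration — gate dedup) A field generated by an `m`-tuple
has `trdeg ≤ m`. -/
private theorem trdeg_adjoin_range_le {m : ℕ} (x : Fin m → ℂ) : Algebra.trdeg ℚ ↥(adjoin ℚ (Set.range x)) ≤ (m : Cardinal) :=
  trdeg_adjoin_le_nat _ (by simpa using Cardinal.mk_range_le (f := x))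

/-! ### The exponential instance -/

/-- `v(u) = e^{u²} − u·e^u`, so that `e^{u²} = u·e^u + v(u)`. -/
def pillayV (u : ℂ) : ℂ := cexp (u ^ 2) - u * cexp u

/-- PILLAY'S TUPLE `z = (u, e^{u²} − u·e^u, u²)`. -/
def pillayTuple (u : ℂ) : Fin 3 → ℂ := ![u, pillayV u, u ^ 2]

/- (port) the genericity hypothesis `PillayHyp u` of the node is spelled out as
   `AlgebraicIndependent ℚ ![u, pillayV u, cexp u, cexp (pillayV u)]` in every statement below. -/

/-- The defining relation of Pillay's tuple on the exponential side: `e^{u²} = u·e^u + v(u)`. -/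
theorem exp_sq_eq (u : ℂ) : cexp (u ^ 2) = u * cexp u + pillayV u := by
  simp [pillayV]

/-- coordinate `0` of Pillay's tuple is `u` -/
@[simp] theorem pillayTuple_zero (u : ℂ) : pillayTuple u 0 = u := rfl
/-- coordinate `1` of Pillay's tuple is `v(u) = e^{u²} − u e^u` -/
@[simp] theorem pillayTuple_one (u : ℂ) : pillayTuple u 1 = pillayV u := rfl
/-- coordinate `2` of Pillay's tuple is `u²` -/
@[simp] theorem pillayTuple_two (u : ℂ) : pillayTuple u 2 = u ^ 2 := rfl

/-- `ℚ(z) ≤`-side: every coordinate of `z` lies in `ℚ(u, v)`. -/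
theorem pillayTuple_mem_adjoin (u : ℂ) (i : Fin 3) : pillayTuple u i ∈ adjoin ℚ (Set.range ![u, pillayV u]) := by
  have hu : u ∈ adjoin ℚ (Set.range ![u, pillayV u]) := subset_adjoin ℚ _ ⟨0, by simp⟩
  have hv : pillayV u ∈ adjoin ℚ (Set.range ![u, pillayV u]) := subset_adjoin ℚ _ ⟨1, by simp⟩
  fin_cases i
  · simpa using hu
  · simpa using hv
  · simpa using pow_mem hu 2

/-- `ℚ(e^z)`-side: every `e^{z_i}` lies in `ℚ(u·e^u + v, e^u, e^v)` (indeed `e^{u²} = u·e^u + v`). -/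
theorem exp_pillayTuple_mem_adjoin (u : ℂ) (i : Fin 3) :
    cexp (pillayTuple u i) ∈ adjoin ℚ (Set.range ![u * cexp u + pillayV u, cexp u, cexp (pillayV u)]) := by
  fin_cases i
  · simpa using subset_adjoin ℚ (Set.range ![u * cexp u + pillayV u, cexp u, cexp (pillayV u)]) ⟨1, by simp⟩
  · simpa using subset_adjoin ℚ (Set.range ![u * cexp u + pillayV u, cexp u, cexp (pillayV u)]) ⟨2, by simp⟩
  · simpa [exp_sq_eq] using
      subset_adjoin ℚ (Set.range ![u * cexp u + pillayV u, cexp u, cexp (pillayV u)]) ⟨0, by simp⟩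

/-- Conversely `ℚ(e^z) = ℚ(u·e^u + v, e^u, e^v)` literally. -/
theorem adjoin_exp_pillayTuple_eq (u : ℂ) :
    adjoin ℚ (Set.range (cexp ∘ pillayTuple u)) = adjoin ℚ (Set.range ![u * cexp u + pillayV u, cexp u, cexp (pillayV u)]) := by
  refine le_antisymm (adjoin_range_le fun i => exp_pillayTuple_mem_adjoin u i) (adjoin_range_le ?_)
  intro i
  fin_cases i
  · simpa [exp_sq_eq] using subset_adjoin ℚ (Set.range (cexp ∘ pillayTuple u)) ⟨2, rfl⟩
  · simpa using subset_adjoin ℚ (Set.range (cexp ∘ pillayTuple u)) ⟨0, rfl⟩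
  · simpa using subset_adjoin ℚ (Set.range (cexp ∘ pillayTuple u)) ⟨1, rfl⟩

/-- **NO MODULAR WITNESS** (`μ(z) = 0`): under `PillayHyp u`, no transcendental number is algebraic over both `ℚ(z)` and `ℚ(e^z)`
for Pillay's tuple `z`. [this node] -/
theorem not_modularWitness_pillayTuple {u : ℂ} (hH : AlgebraicIndependent ℚ ![u, pillayV u, cexp u, cexp (pillayV u)]) : ¬ (∃ s : ℂ, Transcendental ℚ s ∧ IsAlgebraic ↥(adjoin ℚ (Set.range (pillayTuple u))) s ∧
      IsAlgebraic ↥(adjoin ℚ (Set.range (cexp ∘ pillayTuple u))) s) := by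
  rintro ⟨s, hs, hsA, hsB⟩
  refine hs (isAlgebraic_of_nonmodular₄ hH ?_ ?_)
  · exact isAlgebraic_of_isAlgebraic_adjoin _
      (by rintro _ ⟨i, rfl⟩; exact isAlgebraic_of_mem_adjoin (pillayTuple_mem_adjoin u i)) hsA
  · rw [adjoin_exp_pillayTuple_eq] at hsB
    exact hsB

/-- `σ(z) = 0`: every element of `ℚ(z) ∩ ℚ(e^z)` is algebraic (round 10's shared degree vanishes). -/
theorem shared_isAlgebraic_pillayTuple {u : ℂ} (hH : AlgebraicIndependent ℚ ![u, pillayV u, cexp u, cexp (pillayV u)]) {s : ℂ}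
    (h₁ : s ∈ adjoin ℚ (Set.range (pillayTuple u))) (h₂ : s ∈ adjoin ℚ (Set.range (cexp ∘ pillayTuple u))) :
    IsAlgebraic ℚ s := by
  by_contra hs
  exact not_modularWitness_pillayTuple hH (modularWitness_of_shared _ h₁ h₂ hs)

/-- NO DARK LINE / FIXED POINT / LAMBERT POINT / CHAIN / transcendental relation `e^w = P(z)` in the span: if `w ∈ span_ℚ z` has `e^w`
algebraic over `ℚ(z)`, then `e^w ∈ ℚ̄`. -/
theorem exp_isAlgebraic_of_mem_span_pillayTuple {u : ℂ} (hH : AlgebraicIndependent ℚ ![u, pillayV u, cexp u, cexp (pillayV u)]) {w : ℂ}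
    (hw : w ∈ Submodule.span ℚ (Set.range (pillayTuple u)))
    (halg : IsAlgebraic ↥(adjoin ℚ (Set.range (pillayTuple u))) (cexp w)) : IsAlgebraic ℚ (cexp w) := by
  by_contra ht
  exact not_modularWitness_pillayTuple hH (modularWitness_of_exp_isAlgebraic _ hw halg ht)

/-- NO LOG-DARK LINE: if `w ∈ span_ℚ z` is algebraic over `ℚ(e^z)`, then `w ∈ ℚ̄`. -/
theorem isAlgebraic_of_mem_span_pillayTuple {u : ℂ} (hH : AlgebraicIndependent ℚ ![u, pillayV u, cexp u, cexp (pillayV u)]) {w : ℂ}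
    (hw : w ∈ Submodule.span ℚ (Set.range (pillayTuple u)))
    (halg : IsAlgebraic ↥(adjoin ℚ (Set.range (cexp ∘ pillayTuple u))) w) : IsAlgebraic ℚ w := by
  by_contra ht
  exact not_modularWitness_pillayTuple hH (modularWitness_of_isAlgebraic_exp_side _ hw ht halg)

/-- **ENTANGLED** (`ε(z) = 1`): `trdeg ℚ(z, e^z) = 4 < 2 + 3 = trdeg ℚ(z) + trdeg ℚ(e^z)` under `PillayHyp u`. [this node] -/
theorem entangled_pillayTuple {u : ℂ} (hH : AlgebraicIndependent ℚ ![u, pillayV u, cexp u, cexp (pillayV u)]) :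
    Algebra.trdeg ℚ ↥(adjoin ℚ (Set.range (pillayTuple u) ∪ Set.range (cexp ∘ pillayTuple u))) <
      Algebra.trdeg ℚ ↥(adjoin ℚ (Set.range (pillayTuple u))) +
        Algebra.trdeg ℚ ↥(adjoin ℚ (Set.range (cexp ∘ pillayTuple u))) := by
  set K₄ : IntermediateField ℚ ℂ := adjoin ℚ (Set.range ![u, pillayV u, cexp u, cexp (pillayV u)]) with hK₄def
  have huK : u ∈ K₄ := subset_adjoin ℚ _ ⟨0, by simp⟩
  have hvK : pillayV u ∈ K₄ := subset_adjoin ℚ _ ⟨1, by simp⟩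
  have hwK : cexp u ∈ K₄ := subset_adjoin ℚ _ ⟨2, by simp⟩
  have hfK : cexp (pillayV u) ∈ K₄ := subset_adjoin ℚ _ ⟨3, by simp⟩
  have h4 : ((4 : ℕ) : Cardinal) ≤ Algebra.trdeg ℚ ↥K₄ :=
    le_trdeg_of_algebraicIndependent_mem _ hH (fun i => subset_adjoin ℚ _ ⟨i, rfl⟩)
  -- t ≤ 4
  have ht : Algebra.trdeg ℚ ↥(adjoin ℚ (Set.range (pillayTuple u) ∪ Set.range (cexp ∘ pillayTuple u))) ≤
      ((4 : ℕ) : Cardinal) := by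
    refine (trdeg_adjoin_le_of_isAlgebraic (K := K₄) ?_).trans (trdeg_adjoin_range_le _)
    rintro x (⟨i, rfl⟩ | ⟨i, rfl⟩)
    · refine isAlgebraic_of_mem_adjoin ?_
      fin_cases i
      · simpa using huK
      · simpa using hvK
      · simpa using pow_mem huK 2
    · refine isAlgebraic_of_mem_adjoin ?_
      fin_cases i
      · simpa using hwK
      · simpa using hfK
      · simpa [exp_sq_eq] using add_mem (mul_mem huK hwK) hvK
  -- t₁ ≥ 2
  have h2 : AlgebraicIndependent ℚ ![u, pillayV u] := by
    have h' := hH.comp (Fin.castSucc ∘ Fin.castSucc) ((Fin.castSucc_injective _).comp (Fin.castSucc_injective _))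
    have e : (![u, pillayV u, cexp u, cexp (pillayV u)] ∘ (Fin.castSucc ∘ Fin.castSucc) : Fin 2 → ℂ) = ![u, pillayV u] := by
      funext i; fin_cases i <;> rfl
    rwa [e] at h'
  have ht₁ : ((2 : ℕ) : Cardinal) ≤ Algebra.trdeg ℚ ↥(adjoin ℚ (Set.range (pillayTuple u))) :=
    le_trdeg_of_algebraicIndependent_mem _ h2 (by
      intro i; fin_cases i
      · simpa using subset_adjoin ℚ (Set.range (pillayTuple u)) ⟨0, rfl⟩
      · simpa using subset_adjoin ℚ (Set.range (pillayTuple u)) ⟨1, rfl⟩)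
  -- t₂ ≥ 3 : `K₄ ≤ ℚ(e^z)(u)`
  have hle : K₄ ≤ adjoin ℚ (insert u (Set.range (cexp ∘ pillayTuple u))) := by
    have hu : u ∈ adjoin ℚ (insert u (Set.range (cexp ∘ pillayTuple u))) := subset_adjoin ℚ _ (Set.mem_insert _ _)
    have hw : cexp u ∈ adjoin ℚ (insert u (Set.range (cexp ∘ pillayTuple u))) :=
      subset_adjoin ℚ _ (Set.mem_insert_of_mem _ ⟨0, rfl⟩)
    have hf : cexp (pillayV u) ∈ adjoin ℚ (insert u (Set.range (cexp ∘ pillayTuple u))) :=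
      subset_adjoin ℚ _ (Set.mem_insert_of_mem _ ⟨1, rfl⟩)
    have hd : cexp (u ^ 2) ∈ adjoin ℚ (insert u (Set.range (cexp ∘ pillayTuple u))) :=
      subset_adjoin ℚ _ (Set.mem_insert_of_mem _ ⟨2, rfl⟩)
    have hv : pillayV u ∈ adjoin ℚ (insert u (Set.range (cexp ∘ pillayTuple u))) := by
      unfold pillayV; exact sub_mem hd (mul_mem hu hw)
    refine adjoin_range_le ?_
    intro i; fin_cases i
    · exact hu
    · exact hv
    · exact hw
    · exact hf
  have ht₂ : ((3 : ℕ) : Cardinal) ≤ Algebra.trdeg ℚ ↥(adjoin ℚ (Set.range (cexp ∘ pillayTuple u))) := by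
    have hh := (h4.trans (trdeg_mono hle)).trans
      (Literature.NumberTheory.Transcendental.trdeg_adjoin_insert_le (Set.range (cexp ∘ pillayTuple u)) u)
    obtain ⟨k, hk, -⟩ := exists_nat_eq_of_le_natCast (trdeg_adjoin_range_le (cexp ∘ pillayTuple u))
    have hh' : ((4 : ℕ) : Cardinal) ≤ (k : Cardinal) + 1 := hh.trans (add_le_add hk.le le_rfl)
    have : (4 : ℕ) ≤ k + 1 := by exact_mod_cast hh'
    exact le_of_le_of_eq (by exact_mod_cast (by omega : 3 ≤ k)) hk.symm
  calc Algebra.trdeg ℚ ↥(adjoin ℚ (Set.range (pillayTuple u) ∪ Set.range (cexp ∘ pillayTuple u)))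
      ≤ ((4 : ℕ) : Cardinal) := ht
    _ < ((5 : ℕ) : Cardinal) := by exact_mod_cast (by norm_num : (4 : ℕ) < 5)
    _ = ((2 : ℕ) : Cardinal) + ((3 : ℕ) : Cardinal) := by norm_cast
    _ ≤ _ := add_le_add ht₁ ht₂

/-- … so Pillay's tuple is NOT disjoint: it lies on the `Cᵉ` (30352) side of the round-6 split `Cⁿᵘ ⟺ Cᵉ ∧ D`, in the layer
`μ = 0` that NO placement of §1 (nor round 10's `σ`-placements) can reach. -/
theorem not_disjoint_pillayTuple {u : ℂ} (hH : AlgebraicIndependent ℚ ![u, pillayV u, cexp u, cexp (pillayV u)]) :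
    ¬ (Algebra.trdeg ℚ ↥(adjoin ℚ (Set.range (pillayTuple u))) +
        Algebra.trdeg ℚ ↥(adjoin ℚ (Set.range (cexp ∘ pillayTuple u))) ≤
        Algebra.trdeg ℚ ↥(adjoin ℚ (Set.range (pillayTuple u) ∪ Set.range (cexp ∘ pillayTuple u)))) :=
  not_le.mpr (entangled_pillayTuple hH)


/-! ### Pillay's tuple satisfies the first binders of `Cᵉ`: ℚ-linear independence, membership in `ecl ∅` -/

/-- `u` transcendental ⟹ `a + b·u + c·u² = 0` only trivially. -/
theorem quadratic_relation_trivial {u : ℂ} (hu : Transcendental ℚ u) {a b c : ℚ}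
    (h : (a : ℂ) + b * u + c * u ^ 2 = 0) : a = 0 ∧ b = 0 ∧ c = 0 := by
  classical
  set p : Polynomial ℚ := Polynomial.C a + Polynomial.C b * Polynomial.X + Polynomial.C c * Polynomial.X ^ 2 with hp
  have hpu : Polynomial.aeval u p = 0 := by
    simp [hp, h]
  have hp0 : p = 0 := by
    by_contra hne
    exact hu ⟨p, hne, hpu⟩
  have h0 := congrArg (fun q => Polynomial.coeff q 0) hp0
  have h1 := congrArg (fun q => Polynomial.coeff q 1) hp0
  have h2 := congrArg (fun q => Polynomial.coeff q 2) hp0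
  simp [hp, Polynomial.coeff_X, Polynomial.coeff_C, Polynomial.coeff_X_pow] at h0 h1 h2
  exact ⟨h0, h1, h2⟩

/-- **ℚ-LINEAR INDEPENDENCE** of Pillay's tuple under `PillayHyp u` (only `u` transcendental and `v(u) ∉ ℚ(u)^alg` are used). -/
theorem linearIndependent_pillayTuple {u : ℂ} (hH : AlgebraicIndependent ℚ ![u, pillayV u, cexp u, cexp (pillayV u)]) : LinearIndependent ℚ (pillayTuple u) := by
  classical
  have h2 : AlgebraicIndependent ℚ ![u, pillayV u] := by
    have h' := hH.comp (Fin.castSucc ∘ Fin.castSucc) ((Fin.castSucc_injective _).comp (Fin.castSucc_injective _))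
    have e : (![u, pillayV u, cexp u, cexp (pillayV u)] ∘ (Fin.castSucc ∘ Fin.castSucc) : Fin 2 → ℂ) = ![u, pillayV u] := by
      funext i; fin_cases i <;> rfl
    rwa [e] at h'
  have hu : Transcendental ℚ u := by simpa using h2.transcendental 0
  -- `v ∉ ℚ(u)^alg`
  have hv : ¬ IsAlgebraic ↥(adjoin ℚ ({u} : Set ℂ)) (pillayV u) := by
    intro hv
    have htwo : ((2 : ℕ) : Cardinal) ≤ Algebra.trdeg ℚ ↥(adjoin ℚ (Set.range ![u, pillayV u])) :=
      le_trdeg_of_algebraicIndependent_mem _ h2 (fun i => subset_adjoin ℚ _ ⟨i, rfl⟩)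
    have hle : Algebra.trdeg ℚ ↥(adjoin ℚ (Set.range ![u, pillayV u])) ≤ Algebra.trdeg ℚ ↥(adjoin ℚ ({u} : Set ℂ)) := by
      refine trdeg_adjoin_le_of_isAlgebraic ?_
      rintro _ ⟨i, rfl⟩
      fin_cases i
      · simpa using isAlgebraic_of_mem_adjoin (mem_adjoin_simple_self ℚ u)
      · simpa using hv
    have hone : Algebra.trdeg ℚ ↥(adjoin ℚ ({u} : Set ℂ)) ≤ ((1 : ℕ) : Cardinal) :=
      trdeg_adjoin_le_nat _ (by simp)
    have : ((2 : ℕ) : Cardinal) ≤ ((1 : ℕ) : Cardinal) := htwo.trans (hle.trans hone)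
    have : (2 : ℕ) ≤ 1 := by exact_mod_cast this
    omega
  rw [Fintype.linearIndependent_iff]
  intro g hg
  simp only [Fin.sum_univ_three, pillayTuple_zero, pillayTuple_one, pillayTuple_two] at hg
  have hg' : (g 0 : ℂ) * u + (g 1 : ℂ) * pillayV u + (g 2 : ℂ) * u ^ 2 = 0 := by
    simpa [Rat.smul_def] using hg
  by_cases h1 : g 1 = 0
  · have hrel : ((g 0 : ℚ) : ℂ) * u + (g 2 : ℂ) * u ^ 2 = 0 := by simpa [h1] using hg'
    have hq := quadratic_relation_trivial hu (a := 0) (b := g 0) (c := g 2) (by simpa using hrel)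
    intro i; fin_cases i
    · exact hq.2.1
    · exact h1
    · exact hq.2.2
  · exfalso
    apply hv
    have hK : u ∈ adjoin ℚ ({u} : Set ℂ) := mem_adjoin_simple_self ℚ u
    have e : pillayV u = -(((g 0 : ℚ) : ℂ) * u + (g 2 : ℂ) * u ^ 2) / (g 1 : ℂ) := by
      have h1' : ((g 1 : ℚ) : ℂ) ≠ 0 := by exact_mod_cast h1
      field_simp
      linear_combination hg'
    rw [e]
    refine isAlgebraic_of_mem_adjoin (div_mem (neg_mem (add_mem (mul_mem ?_ hK) (mul_mem ?_ (pow_mem hK 2)))) ?_)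
    · exact SubfieldClass.ratCast_mem _ _
    · exact SubfieldClass.ratCast_mem _ _
    · exact SubfieldClass.ratCast_mem _ _

/-- **MEMBERSHIP IN `ecl ∅`**: if `u ∈ ecl ∅` (e.g. `u = e`) then every coordinate of Pillay's tuple lies in `ecl ∅` (Kirby 2010, Lemma
3.3: `ecl ∅` is an exponential subfield). -/
theorem pillayTuple_mem_ecl {u : ℂ} (hu : u ∈ Literature.NumberTheory.Transcendental.ecl (∅ : Set ℂ)) (i : Fin 3) :
    pillayTuple u i ∈ Literature.NumberTheory.Transcendental.ecl (∅ : Set ℂ) := by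
  have hF : ∀ x : ℂ, x ∈ Literature.NumberTheory.Transcendental.Khovanskii.eclSubfield (∅ : Set ℂ) ↔
      x ∈ Literature.NumberTheory.Transcendental.ecl (∅ : Set ℂ) := fun x => Iff.rfl
  have hexp : ∀ x : ℂ, x ∈ Literature.NumberTheory.Transcendental.ecl (∅ : Set ℂ) →
      cexp x ∈ Literature.NumberTheory.Transcendental.ecl (∅ : Set ℂ) :=
    fun x hx => Literature.NumberTheory.Transcendental.Khovanskii.exp_mem_ecl hx
  set F := Literature.NumberTheory.Transcendental.Khovanskii.eclSubfield (∅ : Set ℂ)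
  have huF : u ∈ F := (hF u).mpr hu
  have hu2 : u ^ 2 ∈ F := pow_mem huF 2
  have hv : pillayV u ∈ F := by
    unfold pillayV
    exact sub_mem ((hF _).mpr (hexp _ ((hF _).mp hu2))) (mul_mem huF ((hF _).mpr (hexp _ hu)))
  fin_cases i
  · simpa using hu
  · simpa using (hF _).mp hv
  · simpa using (hF _).mp hu2

/-- `e ∈ ecl ∅`. -/
theorem exp_one_mem_ecl : cexp 1 ∈ Literature.NumberTheory.Transcendental.ecl (∅ : Set ℂ) :=
  Literature.NumberTheory.Transcendental.Khovanskii.exp_mem_ecl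
    (show (1 : ℂ) ∈ Literature.NumberTheory.Transcendental.Khovanskii.eclSubfield (∅ : Set ℂ) from one_mem _)

end Summit.Schanuel.Schanuel.Theorems.RootDecomp1ModularLayer

end
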